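import Literature.Topology.FourManifolds.HomotopySpheresSignature
import HarnessLib

/-!
# The two numerical inputs of `|bP₈| = 28`: realised signatures `8ℤ` and `σ₂ = 224`

Trunk T-4MAN (`FourManifolds`). Third layer under the named fact
`Literature.Topology.FourManifolds.natCard_homotopySphereClass_seven` (`|Θ₇| = 28`, `HCobordism.lean`), below
`Literature.Topology.FourManifolds.HomotopySphereClass.natCard_bP_seven` (`|bP₈| = 28`, `HomotopySpheresBPOrder.lean`).
`HomotopySpheresSignature.lean` vendors the ingredients of Kervaire–Milnor's Cor. 7.6 ("`bP₄ₘ` is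
finite cyclic") on the signature sets `HomotopySphere.signatureSet g m h Σ` of the oriented
s-parallelizable `4m`-manifolds bounded by an oriented homotopy sphere `Σ`, and Kervaire–Milnor's
`σₘ = HomotopySphere.sigmaGen g m h`. The *order* of `bP₄ₘ` needs two further printed facts, both
from Kervaire–Milnor's "Discussion and computations" (*Groups of homotopy spheres I*, Ann. of Math.
77 (1963), p. 530) and proved in Kosinski, *Differential Manifolds* (1993):

* `Literature.Topology.FourManifolds.HomotopySphere.exists_mem_signatureSet_iff_eight_dvd` (named fact): "a given integer `σ`
  occurs as `σ(M)` for some s-parallelizable `M` bounded by a homotopy sphere if and only if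
  `σ ≡ 0 (modulo 8)`" (Kervaire–Milnor p. 530, announced for Part II; Kosinski X.6.2: the image of
  the signature homomorphism `σ : P⁴ⁿ → ℤ` is `8ℤ`);
* `Literature.Topology.FourManifolds.HomotopySphere.sigmaGen_two` (named fact): `σ₂ = 224` (Kervaire–Milnor p. 530:
  `σₘ = 2²ᵐ⁻¹ (2²ᵐ⁻¹ - 1) Bₘ jₘ aₘ / m` from Milnor–Kervaire [18, p. 457]; `m = 2`: `B₂ = 1/30`,
  `j₂ = 240`, `a₂ = 1`; Kosinski IX.8.7 `t₂ = 224`, X.6 p. 217 "`t₂/8 = 28`").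

With Thm. 7.5 (`HomotopySphere.mk_eq_mk_iff_sigmaGen_dvd_sub`) and the two comparison facts of
`HomotopySpheresSignature.lean` they give `bP₈ ≃ 8ℤ/224ℤ`, `|bP₈| = 28`
(`HomotopySpheresBPOrderProofs.lean`).

## Faithfulness notes

* `signatureSet g m h Σ` (sibling file) consists of the signatures of the **oriented**
  s-parallelizable `M` with `bM = Σ` as oriented manifolds (`NullCobordism.IsOrientedBy`,
  `SmoothOrientation.IsCompatible g`); Kervaire–Milnor's sentence is about exactly these `σ(M)`.
  Negative multiples of `8` occur as `σ(-M)`, `b(-M) = -Σ`.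
* `m > 1` is needed (`m = 1`: Rokhlin's theorem gives `16ℤ`), as in Kosinski X.6.2(a) (`n > 1`) and
  Kervaire–Milnor Thm. 7.5.
* `σ₂`: Kervaire–Milnor define `σₘ` through s-parallelizable `M₀` bounded by `S⁴ᵐ⁻¹` (p. 529);
  `sigmaGen g m h` is the least positive element of the subgroup generated by these signatures (all
  orientations of `𝕊ⁿ`), so `σ₂ = 224` says that this subgroup is `224ℤ` — Kosinski IX.8.5/8.7 (the
  signatures of almost-parallelizable closed `8`-manifolds form `t₂ℤ = 224ℤ`; remove or attach a
  disc, Kervaire–Milnor proof of Lemma 7.4). The generator convention `g` only fixes signs and the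
  statement holds for every `g`.

## References

* M. Kervaire, J. Milnor, *Groups of homotopy spheres I*, Ann. of Math. 77 (1963), §7: Lemma 7.4
  and the definition of `σₘ` (p. 529), "Discussion and computations" (p. 530), formula (2)
  (p. 531), table p. 504. [KervaireMilnorAnnals1963]
* A. Kosinski, *Differential Manifolds* (1993): IX.8.5, IX.8.7 (`tₖ`), X.3.1–3.2, X §6 proof of
  Prop. 6.2(a) (p. 216) and p. 217. [Kosinski1993]
-/

open scoped Manifold ContDiff Topology
open Set Function

noncomputable section

namespace Literature.Topology.FourManifolds

namespace HomotopySphere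

/-- **The signatures of the s-parallelizable `4m`-manifolds bounded by homotopy spheres are
exactly the multiples of `8`** (named fact; `n + 1 = 4m`, `1 < m`, any generator convention `g`).
Kervaire–Milnor, *Groups of homotopy spheres I* (1963), §7, "Discussion and computations", p. 530:
"In fact a given integer `σ` occurs as `σ(M)` for some s-parallelizable `M` bounded by a homotopy
sphere if and only if `σ ≡ 0 (modulo 8)`" (announced there for Part II). Printed proof: Kosinski,
*Differential Manifolds* (1993), Ch. X, proof of Prop. 6.2(a), p. 216: the signature homomorphism
`σ : P⁴ⁿ → ℤ` on the group of framed manifolds bounded by homotopy spheres has image `8ℤ` —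
divisibility by `8` because the intersection form of a `π`-manifold is even and unimodular (X.3.1,
[Serre, *Cours d'arithmétique*, V §2]; Kervaire–Milnor p. 528: determinant `±1`), `8` is attained
by the `E₈`-plumbing `M(4n)` (VI.12, IX.7.5; Milnor 1959), and the signatures are closed under sums
and sign change by the boundary connected sum and `σ(-M) = -σ(M)` (X.3.2; Kervaire–Milnor §2).
Here "`σ` occurs as `σ(M)`" is membership in some `signatureSet g m h Σ`
(`HomotopySpheresSignature.lean`: `M` s-parallelizable, `bM = Σ` as oriented manifolds, `σ(M)` the
signature of `M ∪ cone(bM)`). Not proved here: intersection forms of manifolds with boundary and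
plumbing are absent from Mathlib and from the tree. [cite: KervaireMilnorAnnals1963, §7, p. 530 (Discussion and computations), with p. 528] [cite: Kosinski1993, Ch. X §6, proof of Prop. 6.2(a) (p. 216), with X.3.1–3.2, VI.12, IX.7.5] -/
def exists_mem_signatureSet_iff_eight_dvd : Prop :=
  ∀ (n m : ℕ) (h : n + 1 = 4 * m), 1 < m →
    ∀ (g : Literature.AlgebraicTopology.SingularHomology.HomologicalOrientation ℤ (EuclideanSpace ℝ (Fin n)) n) (σ : ℤ),
      (∃ S : HomotopySphere n, σ ∈ signatureSet g m h S) ↔ (8 : ℤ) ∣ σ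

/-- **`σ₂ = 224`** (named fact): Kervaire–Milnor's `σₘ` for `m = 2` — the positive generator of
the group generated by the signatures of the s-parallelizable `8`-manifolds bounded by `S⁷`,
`HomotopySphere.sigmaGen g 2 h` — equals `224`, for every generator convention `g`.
Kervaire–Milnor, *Groups of homotopy spheres I* (1963), §7, p. 530:
"`σₘ = 2²ᵐ⁻¹ (2²ᵐ⁻¹ - 1) Bₘ jₘ aₘ / m` where `Bₘ` denotes the `m`-th Bernoulli number, `jₘ`
denotes the order of the cyclic group `J(π₄ₘ₋₁(SO)) ⊂ Π₄ₘ₋₁`, and `aₘ` equals `1` or `2`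
according as `m` is even or odd", proved in
Milnor–Kervaire, Proc. ICM 1958 [18, p. 457] (Hirzebruch's signature theorem, Bott periodicity);
`m = 2`: `B₂ = 1/30`, `j₂ = 240`, `a₂ = 1`, whence `σ₂ = 8 · 7 · 240 / 60 = 224` and
`|bP₈| = σ₂ / 8 = 28` (table p. 504). Kosinski, *Differential Manifolds* (1993), IX.8.7: the
signatures of almost-parallelizable closed `4k`-manifolds form the group `tₖℤ`,
`tₖ = 2²ᵏ⁻¹ (2²ᵏ⁻¹ - 1) Bₖ j₄ₖ₋₁ aₖ / k`; X.6, p. 217: "`t₂/8 = 28`"; the two groups agree (remove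
a disc from a closed almost-parallelizable manifold: Kervaire–Milnor, proof of Lemma 7.4, p. 529;
attach a disc to an s-parallelizable `M₀` bounded by `S⁴ᵐ⁻¹`: Kosinski, proof of IX.8.7). Not
proved here: the signature theorem, Bott periodicity and `|im J₇| = 240` (Adams) are absent from
Mathlib and from the tree. [cite: KervaireMilnorAnnals1963, §7, p. 530 (formula for σₘ, from their ref. 18) and Lemma 7.4 (p. 529); table p. 504] [cite: Kosinski1993, IX.8.7 (tₖ) and Ch. X §6 p. 217 (t₂/8 = 28)] -/
def sigmaGen_two : Prop :=
  ∀ (g : Literature.AlgebraicTopology.SingularHomology.HomologicalOrientation ℤ (EuclideanSpace ℝ (Fin 7)) 7) (h : 7 + 1 = 4 * 2),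
    sigmaGen g 2 h = 224

end HomotopySphere

end Literature.Topology.FourManifolds
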